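import Mathlib
import HarnessLib
import Summits.HubbardSuperconductivity.HubbardSuperconductivity.Theses.KLProgramme
import Summits.HubbardSuperconductivity.HubbardSuperconductivity.Theorems.KLProgrammeKLRegimeCountertermV16Body

/-!
# Route `KLProgramme` — crux K3, GEN 6: the route decl `KLRegimeCountertermV16 := CountertermP2 klPredsV16 klWindowC` CLOSED by the body
# `KLRegimeSplit.CtJ.countertermP2_klPredsV16` (`…CountertermV16Body`; seat hubbard-kl-k3c3-p2).  Proof only; nothing here asserts superconductivity.
-/

noncomputable section

namespace Summit.HubbardSuperconductivity.HubbardSuperconductivity.Theorems.KLRegimeCounterterm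

set_option linter.dupNamespace false -- summit = problem name (single-conjunct summit), D-0017

/-- **Gen-6 child Counterterm of crux K3, CLOSED**: the route decl `…Theses.KLProgramme.KLRegimeCountertermV16` by name, from the body
`KLRegimeSplit.CtJ.countertermP2_klPredsV16`. -/
theorem KLRegimeCountertermV16_of :
    Summit.HubbardSuperconductivity.HubbardSuperconductivity.Theses.KLProgramme.KLRegimeCountertermV16 :=
  KLRegimeSplit.CtJ.countertermP2_klPredsV16

end Summit.HubbardSuperconductivity.HubbardSuperconductivity.Theorems.KLRegimeCounterterm

end
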